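import Mathlib
import HarnessLib
import Literature.Analysis.FluidPDE.SereginSverakPressureLocalTypeI
import Literature.Analysis.FluidPDE.LocalTypeIWeakSerrinUniform
import Summits.NavierStokesRegularity.NavierStokesRegularity.Theorems.StableStrataDoorClassSlabLevels

/-!
# StableStrataDoorClassZoom — the viscosity-normalising zoom at a LOCALLY Type I point is a local Type I ball with a
# CLASS-UNIFORM level `𝐈(Q(0, 1/2)) ≤ B(ν, M, T, ρ, E₀)` (input F2 of I1⋆ `LocalPointZoomAcrossSolutionsM`)

Helper file of the door family of LADDER-NS N0 (`--supports stmt-NavierStokesRegularity-0056`; nsreg-p6 g15, DIRECTOR-NS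
#100 (2)).  The lineage's `LocalSineTubeDoorLocalPointZoomZoom.exists_zoom_typeIBound_lt_top_of_localTypeI` zooms ONE
classical Leray–Hopf solution, locally Type I in the rate sense at `(x₀, T)`, to a suitable weak solution in the unit parabolic
ball with `𝐈(Q(0, 1/2)) < ⊤` — finite, but with a level and a zoom radius hidden behind existentials fixed AFTER the solution.
For compactness ACROSS solutions of one class the level must be uniform: `classZoom_typeIBound_le` fixes the radius
`R = min ρ √(ν·min(ρ², T))`, `α = R/ν`, `β = R²/ν` and the level `B` BEFORE the solution, in terms of `(ν, M, T, ρ, E₀)` only,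
and proves for EVERY solution of the class (life span `T`, Type-I radius `ρ`, rate `M`, initial kinetic energy `≤ E₀`) that the
zoom is in Albritton–Barker's class on `Q(0,1)` with the zoomed classical gradient, obeys the rate
`(α max(M,0)/√(νβ))/√(−s)`, and has `𝐈(Q(0,1/2)) ≤ B`.  Proof = the lineage's zoom block verbatim, with the unit-scale data
bounded by the class levels of `StableStrataDoorClassSlabLevels` (energy `2E₀`, dissipation `E₀/ν`, gauged pressure
`C^{3/2}(2E₀)^{3/4}K^{3/2}(T + E₀/ν)`) and Albritton–Barker 2019 Lemma 2.5 in the data-uniform form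
`Literature…exists_typeIBound_le_of_rate`.
WHAT THIS IS NOT: not NS regularity; compactness bookkeeping INSIDE the Type-I class; no route, no item.
-/

noncomputable section

set_option linter.dupNamespace false

namespace Summit.NavierStokesRegularity.NavierStokesRegularity.Theorems.StableStrataDoorClassZoom

open Set Filter Topology MeasureTheory
open InnerProductSpace Function TopologicalSpace Metric
open Literature.Analysis.FluidPDE
open scoped ContDiff RealInnerProductSpace ENNReal NNReal

variable {ν T : ℝ}

/-- **The class zoom with a class-uniform local Type-I level** (module docstring). -/
theorem classZoom_typeIBound_le (hν : 0 < ν) (hT : 0 < T) {ρ : ℝ} (hρ : 0 < ρ) (M E₀ : ℝ) :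
    ∃ (R α β : ℝ) (B : ℝ≥0∞), 0 < R ∧ 0 < α ∧ 0 < β ∧ β = R ^ 2 / ν ∧ α = R / ν ∧ β ≤ T ∧ R ≤ ρ ∧ β ≤ ρ ^ 2 ∧
      B ≠ ⊤ ∧
      ∀ (u : ℝ → EuclideanSpace ℝ (Fin 3) → EuclideanSpace ℝ (Fin 3)) (p : ℝ → EuclideanSpace ℝ (Fin 3) → ℝ)
        (x₀ : EuclideanSpace ℝ (Fin 3)),
        IsClassicalNSSolutionOn (Ico 0 T) ν 0 u p → IsLerayHopfOn T ν 0 (u 0) u →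
        VectorCalculus.kineticEnergy (u 0) ≤ E₀ →
        (∀ t ∈ Ico 0 T, T - ρ ^ 2 < t → ∀ x ∈ ball x₀ ρ, ‖u t x‖ * Real.sqrt (ν * (T - t)) ≤ M) →
        IsSuitableWeakSolutionInBall 1 0 (α • stPull β R T x₀ u)
            (α ^ 2 • stPull β R T x₀ fun t x => p t x - (p t 0 - normalisedPressure (u t) 0)) ∧
          HasWeakSpatialGradientOn (parabolicCylinderOpens 1 (0 : ℝ × EuclideanSpace ℝ (Fin 3)))
            (α • stPull β R T x₀ u) ((α * R) • stPull β R T x₀ fun t x => fderiv ℝ (u t) x) ∧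
          (∀ s ∈ Ioo (-1 : ℝ) 0, ∀ y ∈ ball (0 : EuclideanSpace ℝ (Fin 3)) (ρ / R),
            ‖(α • stPull β R T x₀ u) s y‖ ≤ (α * max M 0 / Real.sqrt (ν * β)) / Real.sqrt (-s)) ∧
          typeIBound (parabolicCylinder (1 / 2) (0 : ℝ × EuclideanSpace ℝ (Fin 3)))
            (α • stPull β R T x₀ u)
            (α ^ 2 • stPull β R T x₀ fun t x => p t x - (p t 0 - normalisedPressure (u t) 0))
            ((α * R) • stPull β R T x₀ fun t x => fderiv ℝ (u t) x) ≤ B := by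
  -- scales: `R ≤ ρ`, `R² / ν ≤ min (ρ²) T`
  set δ : ℝ := min (ρ ^ 2) T with hδ
  have hδpos : 0 < δ := lt_min (pow_pos hρ 2) hT
  have hδT : δ ≤ T := min_le_right _ _
  have hδρ : δ ≤ ρ ^ 2 := min_le_left _ _
  set R : ℝ := min ρ (Real.sqrt (ν * δ)) with hR
  have hRpos : 0 < R := lt_min hρ (Real.sqrt_pos.2 (by positivity))
  have hRρ : R ≤ ρ := min_le_left _ _
  set α : ℝ := R / ν with hα
  set β : ℝ := R ^ 2 / ν with hβdef
  have hαpos : 0 < α := by positivity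
  have hβpos : 0 < β := by positivity
  have hβeq : β = α * R := by rw [hβdef, hα]; field_simp
  have hβδ : β ≤ δ := by
    have h1 : R ≤ Real.sqrt (ν * δ) := min_le_right _ _
    have h2 : R ^ 2 ≤ ν * δ := by
      have := pow_le_pow_left₀ hRpos.le h1 2
      rwa [Real.sq_sqrt (by positivity)] at this
    rw [hβdef, div_le_iff₀ hν]; linarith
  have hβT : β ≤ T := hβδ.trans hδT
  have hβρ : β ≤ ρ ^ 2 := hβδ.trans hδρ
  -- ### the CLASS-UNIFORM unit-scale levels of the zooms and A–B Lemma 2.5 with explicit constant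
  set C₁ : ℝ := α * max M 0 / Real.sqrt (ν * β) with hC₁
  set CE : ℝ≥0∞ := ENNReal.ofReal (2 * E₀) with hCE
  set C₀ : ℝ≥0∞ := ‖α‖ₑ ^ 2 * (ENNReal.ofReal (R ^ 3)⁻¹ * CE) with hC₀
  have hC₀top : C₀ ≠ ⊤ :=
    ENNReal.mul_ne_top (by simp) (ENNReal.mul_ne_top ENNReal.ofReal_ne_top ENNReal.ofReal_ne_top)
  set Lcube : ℝ≥0∞ := ENNReal.ofReal (2 * E₀) ^ (3 / 4 : ℝ) *
      ((SNormLESNormFDerivOfEqConst (EuclideanSpace ℝ (Fin 3))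
          (volume : Measure (EuclideanSpace ℝ (Fin 3))) 2 : ℝ≥0∞) ^ (3 / 2 : ℝ) *
        (ENNReal.ofReal T + ENNReal.ofReal (E₀ / ν))) with hLcube
  have hLcube_top : Lcube ≠ ⊤ :=
    ENNReal.mul_ne_top (ENNReal.rpow_ne_top_of_nonneg (by norm_num) ENNReal.ofReal_ne_top)
      (ENNReal.mul_ne_top (ENNReal.rpow_ne_top_of_nonneg (by norm_num) ENNReal.coe_ne_top)
        (ENNReal.add_ne_top.2 ⟨ENNReal.ofReal_ne_top, ENNReal.ofReal_ne_top⟩))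
  set P₁ : ℝ≥0∞ := ‖α ^ 2‖ₑ ^ (3 / 2 : ℝ) * ENNReal.ofReal (β * R ^ 3)⁻¹ *
      ((steinConstThreeHalves : ℝ≥0∞) ^ (3 / 2 : ℝ) * Lcube) with hP₁
  have hP₁top : P₁ ≠ ⊤ :=
    ENNReal.mul_ne_top (ENNReal.mul_ne_top (ENNReal.rpow_ne_top_of_nonneg (by norm_num) enorm_ne_top)
      ENNReal.ofReal_ne_top) (ENNReal.mul_ne_top (ENNReal.rpow_ne_top_of_nonneg (by norm_num) ENNReal.coe_ne_top)
        hLcube_top)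
  set E₁ : ℝ≥0∞ := ENNReal.ofReal ((α * R) ^ 2) * ENNReal.ofReal (β * R ^ 3)⁻¹ * ENNReal.ofReal (E₀ / ν) with hE₁
  have hE₁top : E₁ ≠ ⊤ :=
    ENNReal.mul_ne_top (ENNReal.mul_ne_top ENNReal.ofReal_ne_top ENNReal.ofReal_ne_top) ENNReal.ofReal_ne_top
  obtain ⟨B, hBtop, hB⟩ :=
    exists_typeIBound_le_of_rate C₁ C₀.toNNReal hP₁top hE₁top (R := 1 / 2) (by norm_num)
  refine ⟨R, α, β, B, hRpos, hαpos, hβpos, rfl, rfl, hβT, hRρ, hβρ, hBtop, fun u p x₀ hsol hLH hE hM => ?_⟩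
  -- the gauged pressure
  set q : ℝ → EuclideanSpace ℝ (Fin 3) → ℝ := fun t x => p t x - (p t 0 - normalisedPressure (u t) 0)
    with hq
  -- the `ν`-cylinder `(T - β, T) × B(x₀, R)` inside the slab, and its preimage `Q(0,1)`
  set PO : Opens (ℝ × EuclideanSpace ℝ (Fin 3)) :=
    ⟨Ioo (T - β) T ×ˢ ball x₀ R, isOpen_Ioo.prod isOpen_ball⟩ with hPO
  have hPOslab : (PO : Set (ℝ × EuclideanSpace ℝ (Fin 3))) ⊆
      Ioo 0 T ×ˢ (univ : Set (EuclideanSpace ℝ (Fin 3))) := by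
    rintro ⟨t, x⟩ ⟨ht, -⟩
    exact ⟨⟨by linarith [ht.1], ht.2⟩, mem_univ _⟩
  have hpre1 : stPreimage β R T x₀ PO =
      parabolicCylinderOpens 1 (0 : ℝ × EuclideanSpace ℝ (Fin 3)) := by
    apply Opens.ext
    rw [coe_stPreimage]
    have h := stAffine_preimage_cylinder_eq_parabolicCylinder hν hRpos T x₀ R
    rw [div_self hRpos.ne'] at h
    exact h
  -- suitability of the zoom on `Q(0,1)` with unit viscosity
  have hsuit1 : IsSuitableWeakSolutionOn
      (parabolicCylinderOpens 1 (0 : ℝ × EuclideanSpace ℝ (Fin 3))) 1 0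
      (α • stPull β R T x₀ u) (α ^ 2 • stPull β R T x₀ q) := by
    have h0 := (SereginSverak2002.isSuitableWeakSolutionOn_gauge_of_classical hν hT hsol hLH PO
      hPOslab).stRescale hαpos hRpos hβeq T x₀
    have hvisc : α * ν / R = 1 := by rw [hα, div_mul_cancel₀ R hν.ne', div_self hRpos.ne']
    have hforce : ((α ^ 2 * R) • stPull β R T x₀
        (0 : ℝ → EuclideanSpace ℝ (Fin 3) → EuclideanSpace ℝ (Fin 3))) = 0 := by
      funext s y; simp [stPull]
    rw [hvisc, hforce, hpre1] at h0
    exact h0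
  -- the zoomed classical gradient
  have hGu : HasWeakSpatialGradientOn PO u fun t x => fderiv ℝ (u t) x :=
    hasWeakSpatialGradientOn_of_contDiffOn isOpen_Ioo hPOslab
      ((SereginSverak2002.classical_Ioo hsol).smooth_velocity.of_le (by norm_cast))
  have hGv : HasWeakSpatialGradientOn (parabolicCylinderOpens 1 (0 : ℝ × EuclideanSpace ℝ (Fin 3)))
      (α • stPull β R T x₀ u) ((α * R) • stPull β R T x₀ fun t x => fderiv ℝ (u t) x) := by
    rw [← hpre1]
    exact hGu.stRescale α hβpos hRpos T x₀
  -- ### the energy data of the zoom on the unit ball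
  have hEnergy : ∀ᵐ s ∂(volume.restrict (Ioo ((0 : ℝ × EuclideanSpace ℝ (Fin 3)).1 - 1 ^ 2)
      (0 : ℝ × EuclideanSpace ℝ (Fin 3)).1)),
      ∫⁻ y in ball (0 : ℝ × EuclideanSpace ℝ (Fin 3)).2 1, ‖(α • stPull β R T x₀ u) s y‖ₑ ^ 2 ≤ (C₀.toNNReal : ℝ≥0∞) := by
    have hphys : ∀ᵐ t ∂(volume.restrict (Ioo (T + β * (-1)) (T + β * 0))),
        ∫⁻ x in ball x₀ R, ‖u t x‖ₑ ^ 2 ≤ CE := by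
      refine (ae_restrict_mem measurableSet_Ioo).mono fun t ht => ?_
      have htI : t ∈ Icc 0 T :=
        ⟨by nlinarith [ht.1], by have := ht.2; simp at this; exact this.le⟩
      refine (setLIntegral_le_lintegral _ _).trans ((SereginSverak2002.eEnergy_le hν.le hLH htI).trans ?_)
      rw [hCE]
      exact ENNReal.ofReal_le_ofReal (by linarith)
    have h2 := ae_sliced_setLIntegral_ball_stRescale hβpos hRpos T x₀ x₀ R (-1) 0
      (fun t x => ‖u t x‖ₑ ^ 2) hphys
    rw [finrank_euclideanSpace_fin, sub_self, smul_zero, div_self hRpos.ne'] at h2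
    rw [ENNReal.coe_toNNReal hC₀top]
    have hset : Ioo ((0 : ℝ × EuclideanSpace ℝ (Fin 3)).1 - 1 ^ 2)
        (0 : ℝ × EuclideanSpace ℝ (Fin 3)).1 = Ioo (-1 : ℝ) 0 := by simp
    rw [hset, Prod.snd_zero]
    filter_upwards [h2] with s hs
    have e : ∀ y : EuclideanSpace ℝ (Fin 3), ‖(α • stPull β R T x₀ u) s y‖ₑ ^ 2 =
        ‖α‖ₑ ^ 2 * ‖u (T + β * s) (x₀ + R • y)‖ₑ ^ 2 := by
      intro y
      rw [smul_stPull_apply, enorm_smul, mul_pow]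
    simp only [e]
    rw [lintegral_const_mul' _ _ (by simp)]
    exact mul_le_mul' le_rfl hs
  -- the class `IsSuitableWeakSolutionInBall 1 0`
  have hball : IsSuitableWeakSolutionInBall 1 0 (α • stPull β R T x₀ u)
      (α ^ 2 • stPull β R T x₀ q) := by
    refine ⟨hsuit1, ?_, ⟨_, hGv, ?_⟩, ?_⟩
    · -- energy class
      exact ⟨C₀.toNNReal, hEnergy⟩
    · -- `∫_{Q(0,1)} |∇v|² < ⊤`
      have hpre : parabolicCylinder 1 (0 : ℝ × EuclideanSpace ℝ (Fin 3)) =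
          stAffine β R T x₀ ⁻¹' (Ioo (T - (R * 1) ^ 2 / ν) T ×ˢ ball x₀ (R * 1)) := by
        rw [hβdef, stAffine_preimage_cylinder_eq_parabolicCylinder hν hRpos T x₀ (R * 1),
          mul_div_cancel_left₀ (1 : ℝ) hRpos.ne']
        rfl
      rw [hpre, setLIntegral_frobeniusNormSq_stRescale hβpos hRpos T x₀ (α * R),
        finrank_euclideanSpace_fin]
      refine ENNReal.mul_lt_top (ENNReal.mul_lt_top ENNReal.ofReal_lt_top ENNReal.ofReal_lt_top) ?_
      refine lt_of_le_of_lt (lintegral_mono_set ?_)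
        (SereginSverak2002.lintegral_slab_frobeniusNormSq_fderiv_lt_top' hsol hLH)
      rw [mul_one]
      rintro ⟨t, x⟩ ⟨ht, -⟩
      refine ⟨⟨?_, ht.2⟩, mem_univ _⟩
      have : R ^ 2 / ν = β := rfl
      linarith [ht.1]
    · -- `π ∈ L^{3/2}(Q(0,1))`
      refine ⟨hsuit1.distributional.2.2.1.aestronglyMeasurable, ?_⟩
      have h32 : ((3 : ENNReal) / 2).toReal = 3 / 2 := by rw [ENNReal.toReal_div]; norm_num
      have h32top : (3 : ENNReal) / 2 ≠ ⊤ := (ENNReal.div_lt_top (by simp) (by simp)).ne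
      rw [eLpNorm_eq_lintegral_rpow_enorm_toReal (by norm_num) h32top, h32]
      refine ENNReal.rpow_lt_top_of_nonneg (by positivity) (ne_of_lt ?_)
      have hQ1 : parabolicCylinder 1 (0 : ℝ × EuclideanSpace ℝ (Fin 3)) =
          stAffine β R T x₀ ⁻¹' (PO : Set (ℝ × EuclideanSpace ℝ (Fin 3))) := by
        rw [← coe_stPreimage, hpre1]; rfl
      rw [hQ1]
      show ∫⁻ z in stAffine β R T x₀ ⁻¹' (PO : Set (ℝ × EuclideanSpace ℝ (Fin 3))),
          ‖(α ^ 2 • stPull β R T x₀ q) z.1 z.2‖ₑ ^ (3 / 2 : ℝ) < ⊤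
      rw [setLIntegral_enorm_rpow_stRescale hβpos hRpos T x₀ (α ^ 2) q _ (by norm_num)]
      refine ENNReal.mul_lt_top (ENNReal.mul_lt_top
        (ENNReal.rpow_lt_top_of_nonneg (by norm_num) enorm_ne_top) ENNReal.ofReal_lt_top) ?_
      exact lt_of_le_of_lt (lintegral_mono_set hPOslab)
        (SereginSverak2002.lintegral_slab_gauged_pressure_lt_top hν hT hsol hLH)
  -- the Type-I rate of the zoom on `(-1, 0) × B(0, ρ/R)` from the LOCAL rate of `u`
  have hrate : ∀ s ∈ Ioo (-1 : ℝ) 0, ∀ y ∈ ball (0 : EuclideanSpace ℝ (Fin 3)) (ρ / R),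
      ‖(α • stPull β R T x₀ u) s y‖ ≤ C₁ / Real.sqrt (-s) := by
    intro s hs y hy
    have hs0 : 0 < -s := by linarith [hs.2]
    have htI : T + β * s ∈ Ico 0 T := by
      constructor
      · nlinarith [hs.1, hβT]
      · nlinarith [hs.2, hβpos]
    have htρ : T - ρ ^ 2 < T + β * s := by nlinarith [hs.1, hβρ, hβpos]
    have hx : x₀ + R • y ∈ ball x₀ ρ := by
      rw [mem_ball, dist_eq_norm, add_sub_cancel_left, norm_smul, Real.norm_of_nonneg hRpos.le]
      have hy' : ‖y‖ < ρ / R := by simpa using hy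
      calc R * ‖y‖ < R * (ρ / R) := mul_lt_mul_of_pos_left hy' hRpos
        _ = ρ := mul_div_cancel₀ ρ hRpos.ne'
    have hb := hM (T + β * s) htI htρ (x₀ + R • y) hx
    have hsq : Real.sqrt (ν * (T - (T + β * s))) = Real.sqrt (ν * β) * Real.sqrt (-s) := by
      rw [show ν * (T - (T + β * s)) = (ν * β) * (-s) by ring, Real.sqrt_mul (by positivity)]
    rw [hsq] at hb
    have hνβ : 0 < Real.sqrt (ν * β) := Real.sqrt_pos.2 (by positivity)
    have hspos : 0 < Real.sqrt (-s) := Real.sqrt_pos.2 hs0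
    have hb' : ‖u (T + β * s) (x₀ + R • y)‖ * (Real.sqrt (ν * β) * Real.sqrt (-s)) ≤ max M 0 :=
      hb.trans (le_max_left _ _)
    rw [smul_stPull_apply, norm_smul, Real.norm_of_nonneg hαpos.le, hC₁, div_div,
      le_div_iff₀ (by positivity)]
    calc α * ‖u (T + β * s) (x₀ + R • y)‖ * (Real.sqrt (ν * β) * Real.sqrt (-s))
        = α * (‖u (T + β * s) (x₀ + R • y)‖ * (Real.sqrt (ν * β) * Real.sqrt (-s))) := by ring
      _ ≤ α * max M 0 := mul_le_mul_of_nonneg_left hb' hαpos.le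
  -- the rate on the unit ball `Q(0,1)` (as `R ≤ ρ`, `B(0,1) ⊆ B(0, ρ/R)`) and A–B Lemma 2.5
  have hrateQ : ∀ t' x', (t', x') ∈ parabolicCylinder 1 (0 : ℝ × EuclideanSpace ℝ (Fin 3)) →
      ‖(α • stPull β R T x₀ u) t' x'‖ ≤ C₁ / Real.sqrt ((0 : ℝ × EuclideanSpace ℝ (Fin 3)).1 - t') := by
    intro t' x' hz
    rw [SuitableCompactness.mem_parabolicCylinder_zero] at hz
    obtain ⟨⟨h1, h2⟩, h3⟩ := hz
    have hx' : x' ∈ ball (0 : EuclideanSpace ℝ (Fin 3)) (ρ / R) := by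
      rw [mem_ball_zero_iff]
      have h1R : (1 : ℝ) ≤ ρ / R := by rw [le_div_iff₀ hRpos, one_mul]; exact hRρ
      simp only at h3
      exact lt_of_lt_of_le h3 h1R
    have h := hrate t' ⟨by simpa using h1, h2⟩ x' hx'
    simpa using h
  -- ### the pressure and dissipation data of the zoom on the unit ball (explicit class levels)
  have hQ1 : parabolicCylinder 1 (0 : ℝ × EuclideanSpace ℝ (Fin 3)) =
      stAffine β R T x₀ ⁻¹' (PO : Set (ℝ × EuclideanSpace ℝ (Fin 3))) := by
    rw [← coe_stPreimage, hpre1]; rfl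
  have hP₁v : ∫⁻ w in parabolicCylinder 1 (0 : ℝ × EuclideanSpace ℝ (Fin 3)),
      ‖(α ^ 2 • stPull β R T x₀ q) w.1 w.2‖ₑ ^ (3 / 2 : ℝ) ≤ P₁ := by
    rw [hQ1, setLIntegral_enorm_rpow_stRescale hβpos hRpos T x₀ (α ^ 2) q _ (by norm_num),
      finrank_euclideanSpace_fin, hP₁]
    gcongr
    exact (lintegral_mono_set hPOslab).trans
      (StableStrataDoorClassSlabLevels.lintegral_slab_gauged_pressure_le hν hT hsol hLH hE)
  have hE₁v : ∫⁻ w in parabolicCylinder 1 (0 : ℝ × EuclideanSpace ℝ (Fin 3)),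
      ENNReal.ofReal (frobeniusNormSq (((α * R) • stPull β R T x₀ fun t x => fderiv ℝ (u t) x) w.1 w.2)) ≤ E₁ := by
    rw [hQ1, setLIntegral_frobeniusNormSq_stRescale hβpos hRpos T x₀ (α * R), finrank_euclideanSpace_fin, hE₁]
    gcongr
    exact (lintegral_mono_set hPOslab).trans
      (StableStrataDoorClassSlabLevels.lintegral_slab_frobeniusNormSq_fderiv_le hν hT hsol hLH hE)
  exact ⟨hball, hGv, hrate, hB 0 _ _ _ hball hrateQ hGv hEnergy hP₁v hE₁v⟩


end Summit.NavierStokesRegularity.NavierStokesRegularity.Theorems.StableStrataDoorClassZoom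

end
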